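/-
Copyright (c) 2026. All rights reserved.
Released under Apache 2.0 license as described in the file LICENSE.
-/
import Mathlib
import HarnessLib
import Literature.MathematicalPhysics.QuantumLattice.GaugeGroups
import Literature.MathematicalPhysics.QuantumFieldTheory.ConstructiveQFTWave0
import Literature.MathematicalPhysics.QuantumFieldTheory.LatticeGaugeProofs
import Literature.MathematicalPhysics.QuantumFieldTheory.U1GinibreComparison
import Literature.MathematicalPhysics.QuantumLattice.AbelianFieldTensor
import Literature.MathematicalPhysics.QuantumLattice.AbelianMagneticFlux
import Summits.Ventures.LatticeQCDFlow.Exactness.SymmetricMetropolis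
import Summits.Ventures.LatticeQCDFlow.Exactness.CompactHaar
import Summits.Ventures.LatticeQCDFlow.Scaling.LatticePeeling
import Summits.Ventures.LatticeQCDFlow.Scaling.SliceTwistWitness
import Summits.Ventures.LatticeQCDFlow.Scaling.FluxTunnellingU1Explicit
import Summits.Ventures.LatticeQCDFlow.Scaling.BoxSpreadWitness
import Summits.Ventures.LatticeQCDFlow.Scaling.BoxTouch
import Summits.Ventures.LatticeQCDFlow.Scaling.FluxTunnellingU1MaxPlaquette
import Summits.Ventures.LatticeQCDFlow.Scaling.FluxInsertionKernel
import Summits.Ventures.LatticeQCDFlow.Scaling.FluxInsertionBox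
import Summits.Ventures.LatticeQCDFlow.Scaling.ConvolutionPowerCompensation
import Summits.Ventures.LatticeQCDFlow.Scaling.FluxInsertionSharpFloor
import Summits.Ventures.LatticeQCDFlow.Scaling.FluxInsertionSharpFloorInstances
import Summits.Ventures.LatticeQCDFlow.Scaling.FluxInsertionSharpRate
import Literature.MathematicalPhysics.QuantumFieldTheory.TorusFreeTransfer
import Summits.Ventures.LatticeQCDFlow.Scaling.FluxInsertionHeightIdentity

import Summits.Ventures.LatticeQCDFlow.Scaling.FluxInsertionHeightLaw

/-!
# Discrete torus potentials and the HALF-WAY configuration of the block insertion (item 107a)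

HONEST FRAMING: exact (Metropolis-corrected) sampling algorithms for lattice gauge theory;
figures of merit are autocorrelation/cost numbers at stated couplings and volumes; no
continuum-physics claim.

Venture `LatticeQCDFlow` (cell pub-lqcd), topic `Scaling`, FANOUT row 29 (theory2, gen-20), item 107a
(imports item 106b).  NEW WORK; nothing here is cited as a fact.  `U(1)` on the two-torus `(ℤ/L)²`,
plaquettes in the `(0,1)` plane, `α_l = boxAlpha l`, `R` = the `N = (l+1)² − 4` touching positions
(`inR`), `M = L² − N`.

* §1 `potField c` — a configuration with PRESCRIBED plaquette angles `c a b` (indexed by coordinate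
  representatives, total zero): the column means of `c` are integrated along direction `0` into the
  direction-`1` links, the mean-free remainder along direction `1` into the direction-`0` links
  (an axial-gauge lattice Hodge decomposition); `plaquetteHolonomy_potField`.
* §2 bookkeeping in `d = 2`: action and charge of a configuration from its plaquette angles.
* §3 the half-way TABLE `halfF l L` (angle `−α_l/2` on `R`, `π/M` off `R`): total zero, bounds,
  and the bookkeeping identity giving the common action value `N(1 − cos(α_l/2)) + M(1 − cos(π/M))`
  of the configuration `potField (halfF l L)` before and after the insertion (item 107b) — the
  conjectured value of the min–max height (THEORY-2.md §4 C9″b), there turned into a CEILING.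
-/

noncomputable section

open MeasureTheory Filter Topology Real
open scoped ENNReal
open Literature.MathematicalPhysics.QuantumFieldTheory Literature.MathematicalPhysics.QuantumLattice
open Summit.Ventures.LatticeQCDFlow.Exactness

namespace Summit.Ventures.LatticeQCDFlow.Theory2.Lattice.Flux

/-! ## §1 Discrete potentials with prescribed plaquettes -/

section Potential

variable {L : ℕ} [NeZero L]

/-- Column mean `r(s) = (1/L) Σ_{t<L} c(s,t)` of a table of plaquette angles. [folklore] -/
def colMean (L : ℕ) (c : ℕ → ℕ → ℝ) (s : ℕ) : ℝ := (∑ t ∈ Finset.range L, c s t) / L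

/-- The POTENTIAL FIELD of a table `c` of plaquette angles: direction-`1` links carry the
accumulated column means `Σ_{s' < x₀} r(s')`, direction-`0` links carry minus the accumulated
mean-free remainder `−Σ_{t' < x₁} (c(x₀,t') − r(x₀))`. [folklore] -/
def potField (c : ℕ → ℕ → ℝ) : GaugeConfig 2 L Circle := fun e =>
  if e.2 = 1 then Circle.exp (∑ s ∈ Finset.range (e.1 0).val, colMean L c s)
  else Circle.exp (-∑ t ∈ Finset.range (e.1 1).val, (c (e.1 0).val t - colMean L c (e.1 0).val))

omit [NeZero L] in
/-- Direction-`0` links of the potential field. [folklore] -/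
theorem potField_horiz (c : ℕ → ℕ → ℝ) (x : Site 2 L) :
    potField c (x, 0) =
      Circle.exp (-∑ t ∈ Finset.range (x 1).val, (c (x 0).val t - colMean L c (x 0).val)) := by
  dsimp only [potField]
  rw [if_neg (show (0 : Fin 2) ≠ 1 by decide)]

omit [NeZero L] in
/-- Direction-`1` links of the potential field. [folklore] -/
theorem potField_vert (c : ℕ → ℕ → ℝ) (x : Site 2 L) :
    potField c (x, 1) = Circle.exp (∑ s ∈ Finset.range (x 0).val, colMean L c s) := by
  dsimp only [potField]
  rw [if_pos rfl]

omit [NeZero L] in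
/-- The remainder of a column is mean-free. [folklore] -/
theorem sum_sub_colMean (hL : L ≠ 0) (c : ℕ → ℕ → ℝ) (s : ℕ) :
    ∑ t ∈ Finset.range L, (c s t - colMean L c s) = 0 := by
  have hL' : (L : ℝ) ≠ 0 := by exact_mod_cast hL
  rw [Finset.sum_sub_distrib, Finset.sum_const, Finset.card_range, nsmul_eq_mul, colMean]
  field_simp
  ring

omit [NeZero L] in
/-- The column means of a zero-total table sum to zero. [folklore] -/
theorem sum_colMean {c : ℕ → ℕ → ℝ} (hc : ∑ s ∈ Finset.range L, ∑ t ∈ Finset.range L, c s t = 0) :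
    ∑ s ∈ Finset.range L, colMean L c s = 0 := by
  simp only [colMean]
  rw [← Finset.sum_div, hc, zero_div]

omit [NeZero L] in
/-- **The plaquettes of the potential field are the prescribed ones**: for a zero-total table `c`,
`P_{01}(x) = e^{i c(x₀,x₁)}` (the wrap-around rows and columns are consistent because every
column remainder and the row of means are mean-free). [folklore] -/
theorem plaquetteHolonomy_potField (hL : 1 < L) {c : ℕ → ℕ → ℝ}
    (hc : ∑ s ∈ Finset.range L, ∑ t ∈ Finset.range L, c s t = 0) (x : Site 2 L) :
    plaquetteHolonomy (potField c) x 0 1 = Circle.exp (c (x 0).val (x 1).val) := by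
  haveI : Fact (1 < L) := ⟨hL⟩
  have h00 : (x.shift 0) 0 = x 0 + 1 := by simp [Site.shift]
  have h10 : (x.shift 1) 0 = x 0 := by simp [Site.shift]
  have h11 : (x.shift 1) 1 = x 1 + 1 := by simp [Site.shift]
  have e1 : potField c (x.shift 0, 1) =
      Circle.exp (∑ s ∈ Finset.range (x 0 + 1).val, colMean L c s) := by
    rw [potField_vert, h00]
  have e2 : potField c (x.shift 1, 0) =
      Circle.exp (-∑ t ∈ Finset.range (x 1 + 1).val, (c (x 0).val t - colMean L c (x 0).val)) := by
    rw [potField_horiz, h10, h11]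
  have hv : ∑ s ∈ Finset.range (x 0 + 1).val, colMean L c s =
      ∑ s ∈ Finset.range (x 0).val, colMean L c s + colMean L c (x 0).val := by
    rw [val_add_one_eq (x 0)]
    split_ifs with h
    · have h2 := sum_colMean hc
      rw [show Finset.range L = Finset.range ((x 0).val + 1) from congrArg _ h,
        Finset.sum_range_succ] at h2
      rw [Finset.sum_range_zero]
      linarith
    · exact Finset.sum_range_succ _ _
  have hh : ∑ t ∈ Finset.range (x 1 + 1).val, (c (x 0).val t - colMean L c (x 0).val) =
      ∑ t ∈ Finset.range (x 1).val, (c (x 0).val t - colMean L c (x 0).val) +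
        (c (x 0).val (x 1).val - colMean L c (x 0).val) := by
    rw [val_add_one_eq (x 1)]
    split_ifs with h
    · have h2 := sum_sub_colMean (show L ≠ 0 by omega) c (x 0).val
      rw [show Finset.range L = Finset.range ((x 1).val + 1) from congrArg _ h,
        Finset.sum_range_succ] at h2
      rw [Finset.sum_range_zero]
      linarith
    · exact Finset.sum_range_succ _ _
  rw [plaquetteHolonomy, potField_horiz, e1, e2, potField_vert, hv, hh, ← Circle.exp_neg,
    ← Circle.exp_neg, ← Circle.exp_add, ← Circle.exp_add, ← Circle.exp_add]
  congr 1
  ring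

end Potential

/-! ## §2 Action and charge from the plaquette angles (`d = 2`) -/

section Bookkeeping

variable {L : ℕ} [NeZero L]

/-- A site sum of a function of the coordinate representatives is a double range sum. [folklore] -/
theorem sum_site_val_eq (g : ℕ → ℕ → ℝ) :
    ∑ x : Site 2 L, g (x 0).val (x 1).val = ∑ a ∈ Finset.range L, ∑ b ∈ Finset.range L, g a b := by
  rw [Fintype.sum_equiv (piFinTwoEquiv fun _ => ZMod L) (fun x : Site 2 L => g (x 0).val (x 1).val)
    (fun ab : ZMod L × ZMod L => g ab.1.val ab.2.val) (fun x => rfl), Fintype.sum_prod_type]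
  show ∑ a : ZMod L, ∑ b : ZMod L, g a.val b.val = _
  have hinner : ∀ a : ZMod L, ∑ b : ZMod L, g a.val b.val = ∑ j ∈ Finset.range L, g a.val j :=
    fun a => sum_zmod_val (g a.val)
  simp only [hinner]
  exact sum_zmod_val (fun i => ∑ j ∈ Finset.range L, g i j)

/-- **Wilson action from plaquette angles**: if `P_{01}(x) = e^{i g(x₀,x₁)}` then
`S(U) = Σ_{a,b<L} (1 − cos g(a,b))`. [folklore] -/
theorem wilsonAction_of_plaquette_exp {U : GaugeConfig 2 L Circle} {g : ℕ → ℕ → ℝ}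
    (hU : ∀ x : Site 2 L, plaquetteHolonomy U x 0 1 = Circle.exp (g (x 0).val (x 1).val)) :
    wilsonAction u1Rep U = ∑ a ∈ Finset.range L, ∑ b ∈ Finset.range L, (1 - Real.cos (g a b)) := by
  rw [wilsonAction_u1_eq, ← sum_site_val_eq (fun a b => 1 - Real.cos (g a b))]
  refine Fintype.sum_equiv plaquetteEquivSite _ _ fun q => ?_
  obtain ⟨h0, h1⟩ := plaquette_dirs_eq q
  rw [h0, h1, hU, Circle.coe_exp, Complex.exp_ofReal_mul_I_re]
  rfl

/-- **Charge from field tensors**: if `F_{01}(x) = g(x₀,x₁)` then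
`Q = (Σ_{a,b<L} g(a,b))/(2π)`. [folklore] -/
theorem topCharge_of_fieldTensor {U : GaugeConfig 2 L Circle} {g : ℕ → ℕ → ℝ}
    (hU : ∀ x : Site 2 L, abelianFieldTensor U x 0 1 = g (x 0).val (x 1).val) :
    topCharge (0 : Site 2 L) 0 1 U = (∑ a ∈ Finset.range L, ∑ b ∈ Finset.range L, g a b) / (2 * π) := by
  have hc0 : ∀ s t : ZMod L,
      ((0 : Site 2 L) + Pi.single (0 : Fin 2) s + Pi.single (1 : Fin 2) t : Site 2 L) 0 = s ∧
      ((0 : Site 2 L) + Pi.single (0 : Fin 2) s + Pi.single (1 : Fin 2) t : Site 2 L) 1 = t := by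
    intro s t; constructor <;> simp
  unfold topCharge magneticFlux
  simp only [hU, (hc0 _ _).1, (hc0 _ _).2]
  have hinner : ∀ s : ZMod L, ∑ t : ZMod L, g s.val t.val =
      ∑ j ∈ Finset.range L, g s.val j := fun s => sum_zmod_val (g s.val)
  simp only [hinner]
  rw [sum_zmod_val (fun i => ∑ j ∈ Finset.range L, g i j)]

end Bookkeeping

/-! ## §3 The half-way configuration of the block insertion -/

section HalfWayTable

variable {l L : ℕ}

/-- Affine functions of the box table sum to `2π u + L² v`. [folklore] -/
theorem sum_boxF_affine (hl : 2 ≤ l) (hlL : l + 1 ≤ L) (u v : ℝ) :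
    ∑ a ∈ Finset.range L, ∑ b ∈ Finset.range L, (boxF l a b * u + v) =
      2 * π * u + (L : ℝ) ^ 2 * v := by
  simp only [Finset.sum_add_distrib, Finset.sum_const, Finset.card_range, nsmul_eq_mul,
    ← Finset.sum_mul]
  rw [sum_boxF hl hlL]
  ring

/-- `M = L² − N` is at least `4` when the box fits. [folklore] -/
theorem four_le_boxM (hl : 2 ≤ l) (hlL : l + 1 ≤ L) : 4 ≤ L ^ 2 - ((l + 1) * (l + 1) - 4) := by
  have h : (l + 1) ^ 2 ≤ L ^ 2 := Nat.pow_le_pow_left hlL 2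
  have h4 : 4 ≤ (l + 1) * (l + 1) := by nlinarith
  rw [sq, sq] at h
  rw [sq]
  omega

/-- `M = L² − N` as a real number: `L² − (l−1)(l+3)`. [folklore] -/
theorem natCast_boxM (hl : 2 ≤ l) (hlL : l + 1 ≤ L) :
    (((L ^ 2 - ((l + 1) * (l + 1) - 4) : ℕ)) : ℝ) = (L : ℝ) ^ 2 - ((l : ℝ) - 1) * ((l : ℝ) + 3) := by
  have h : (l + 1) ^ 2 ≤ L ^ 2 := Nat.pow_le_pow_left hlL 2
  have h4 : 4 ≤ (l + 1) * (l + 1) := by nlinarith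
  have hN : (l + 1) * (l + 1) - 4 ≤ L ^ 2 := by rw [sq] at h; omega
  rw [Nat.cast_sub hN, natCast_boxN hl]
  push_cast
  ring

/-- `0 < M` as a real. [folklore] -/
theorem boxM_pos (hl : 2 ≤ l) (hlL : l + 1 ≤ L) :
    (0 : ℝ) < (((L ^ 2 - ((l + 1) * (l + 1) - 4) : ℕ)) : ℝ) := by
  have := four_le_boxM hl hlL
  exact_mod_cast (show 0 < L ^ 2 - ((l + 1) * (l + 1) - 4) by omega)

/-- `π/M ≤ π/4`. [folklore] -/
theorem pi_div_boxM_le (hl : 2 ≤ l) (hlL : l + 1 ≤ L) :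
    π / (((L ^ 2 - ((l + 1) * (l + 1) - 4) : ℕ)) : ℝ) ≤ π / 4 := by
  have h4 : (4 : ℝ) ≤ (((L ^ 2 - ((l + 1) * (l + 1) - 4) : ℕ)) : ℝ) := by
    exact_mod_cast four_le_boxM hl hlL
  exact div_le_div_of_nonneg_left Real.pi_pos.le (by norm_num) h4

/-- `0 < π/M`. [folklore] -/
theorem pi_div_boxM_pos (hl : 2 ≤ l) (hlL : l + 1 ≤ L) :
    0 < π / (((L ^ 2 - ((l + 1) * (l + 1) - 4) : ℕ)) : ℝ) :=
  div_pos Real.pi_pos (boxM_pos hl hlL)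

variable (l L) in
/-- The HALF-WAY table of plaquette angles: `−α_l/2` on the touching positions, `π/M` elsewhere.
[folklore] -/
def halfF (a b : ℕ) : ℝ :=
  if inR l a b then -(boxAlpha l / 2) else π / (((L ^ 2 - ((l + 1) * (l + 1) - 4) : ℕ)) : ℝ)

/-- The half-way table as an affine function of the box table. [folklore] -/
theorem halfF_eq_affine (hl : 2 ≤ l) (a b : ℕ) :
    halfF l L a b = boxF l a b *
        (-(1 / 2) - π / (((L ^ 2 - ((l + 1) * (l + 1) - 4) : ℕ)) : ℝ) / boxAlpha l) +
      π / (((L ^ 2 - ((l + 1) * (l + 1) - 4) : ℕ)) : ℝ) := by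
  have hα := (boxAlpha_pos hl).ne'
  unfold halfF boxF
  split_ifs
  · field_simp
    ring
  · ring

/-- Bounds: `−π/2 < halfF ≤ π/4`. [folklore] -/
theorem halfF_bounds (hl : 2 ≤ l) (hlL : l + 1 ≤ L) (a b : ℕ) :
    -(π / 2) < halfF l L a b ∧ halfF l L a b ≤ π / 4 := by
  have hα := boxAlpha_pos hl
  have hαπ := boxAlpha_lt_pi hl
  have h1 := pi_div_boxM_le hl hlL
  have h2 := pi_div_boxM_pos hl hlL
  unfold halfF
  split_ifs
  · constructor <;> linarith [Real.pi_pos]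
  · constructor <;> linarith [Real.pi_pos]

/-- Bounds: `0 < boxF + halfF ≤ π/2`. [folklore] -/
theorem boxF_add_halfF_bounds (hl : 2 ≤ l) (hlL : l + 1 ≤ L) (a b : ℕ) :
    0 < boxF l a b + halfF l L a b ∧ boxF l a b + halfF l L a b ≤ π / 2 := by
  have hα := boxAlpha_pos hl
  have hαπ := boxAlpha_lt_pi hl
  have h1 := pi_div_boxM_le hl hlL
  have h2 := pi_div_boxM_pos hl hlL
  unfold halfF boxF
  split_ifs
  · constructor <;> linarith [Real.pi_pos]
  · constructor <;> linarith [Real.pi_pos]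

/-- The half-way table has total zero: `−N α_l/2 + M · π/M = −π + π`. [folklore] -/
theorem sum_halfF (hl : 2 ≤ l) (hlL : l + 1 ≤ L) :
    ∑ a ∈ Finset.range L, ∑ b ∈ Finset.range L, halfF l L a b = 0 := by
  have hα := (boxAlpha_pos hl).ne'
  have hM := (boxM_pos hl hlL).ne'
  have hN : 2 * π / boxAlpha l = ((l : ℝ) - 1) * ((l : ℝ) + 3) := by
    obtain ⟨h1', h3'⟩ := boxDen_ne_zero hl
    unfold boxAlpha
    field_simp
  have hMr := natCast_boxM hl hlL
  simp only [halfF_eq_affine hl]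
  rw [sum_boxF_affine hl hlL]
  set m : ℝ := (((L ^ 2 - ((l + 1) * (l + 1) - 4) : ℕ)) : ℝ) with hm
  have : 2 * π * (-(1 / 2) - π / m / boxAlpha l) + (L : ℝ) ^ 2 * (π / m) =
      -π + π / m * ((L : ℝ) ^ 2 - 2 * π / boxAlpha l) := by
    field_simp
    ring
  rw [this, hN, ← hMr, div_mul_cancel₀ _ hM]
  ring

/-- `1 − cos` of the half-way angles as an affine function of the box table. [folklore] -/
theorem one_sub_cos_halfF (hl : 2 ≤ l) (a b : ℕ) :
    1 - Real.cos (halfF l L a b) = boxF l a b *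
        ((Real.cos (π / (((L ^ 2 - ((l + 1) * (l + 1) - 4) : ℕ)) : ℝ)) -
          Real.cos (boxAlpha l / 2)) / boxAlpha l) +
      (1 - Real.cos (π / (((L ^ 2 - ((l + 1) * (l + 1) - 4) : ℕ)) : ℝ))) := by
  have hα := (boxAlpha_pos hl).ne'
  unfold halfF boxF
  split_ifs
  · rw [Real.cos_neg]
    field_simp
    ring
  · ring

/-- `1 − cos` of the inserted angles as the same affine function. [folklore] -/
theorem one_sub_cos_boxF_add_halfF (hl : 2 ≤ l) (a b : ℕ) :
    1 - Real.cos (boxF l a b + halfF l L a b) = boxF l a b *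
        ((Real.cos (π / (((L ^ 2 - ((l + 1) * (l + 1) - 4) : ℕ)) : ℝ)) -
          Real.cos (boxAlpha l / 2)) / boxAlpha l) +
      (1 - Real.cos (π / (((L ^ 2 - ((l + 1) * (l + 1) - 4) : ℕ)) : ℝ))) := by
  have hα := (boxAlpha_pos hl).ne'
  unfold halfF boxF
  split_ifs
  · rw [show boxAlpha l + -(boxAlpha l / 2) = boxAlpha l / 2 by ring]
    field_simp
    ring
  · rw [zero_add]
    ring

/-- The common value `N(1 − cos(α_l/2)) + M(1 − cos(π/M))` of the two actions, from the affine
bookkeeping. [folklore] -/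
theorem halfWay_action_value (hl : 2 ≤ l) (hlL : l + 1 ≤ L) :
    2 * π * ((Real.cos (π / (((L ^ 2 - ((l + 1) * (l + 1) - 4) : ℕ)) : ℝ)) -
          Real.cos (boxAlpha l / 2)) / boxAlpha l) +
        (L : ℝ) ^ 2 * (1 - Real.cos (π / (((L ^ 2 - ((l + 1) * (l + 1) - 4) : ℕ)) : ℝ))) =
      (((l + 1) * (l + 1) - 4 : ℕ) : ℝ) * (1 - Real.cos (boxAlpha l / 2)) +
        ((L ^ 2 - ((l + 1) * (l + 1) - 4) : ℕ) : ℝ) *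
          (1 - Real.cos (π / ((L ^ 2 - ((l + 1) * (l + 1) - 4) : ℕ) : ℝ))) := by
  have hα := (boxAlpha_pos hl).ne'
  have hN : 2 * π / boxAlpha l = ((l : ℝ) - 1) * ((l : ℝ) + 3) := by
    obtain ⟨h1', h3'⟩ := boxDen_ne_zero hl
    unfold boxAlpha
    field_simp
  rw [natCast_boxM hl hlL, natCast_boxN hl, ← hN]
  field_simp
  ring

end HalfWayTable

end Summit.Ventures.LatticeQCDFlow.Theory2.Lattice.Flux

end
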